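import Summits.QuantumFields.YangMills.Theorems.UnitScaleTiltProp7TransplantBumpRows
import Summits.QuantumFields.YangMills.Theorems.UnitScaleTiltProp7TransplantGen0Numbers
import HarnessLib

/-!
# Route `UnitScaleTilt`, crux K1 «MinimiserStabilityRegPr» (stmt-QuantumFields-19200), route-R E′ path (α′), (E1-b) at the CURVED background, (A-cov) gen-0, FILE «NEAR DATUM»:
# THE gen-0 NEAR DATUM `u⁰ := ψ̃•R(Fr)Y` (`ψ̃` = the bump interpolant of `ψ|_C`, ✓ `Prop7TransplantBumpRows`) — `u⁰ = V⁰` ON THE CENTRES, and its two door numbers `N₃⁰ = Σ_z √hs(Δ_U u⁰ z)`,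
# `N₄⁰ = √Σ_z ω z²·hs(Δ_U u⁰ z)` on the ball `S′ = {tdist(·,b) ≤ 9n + L^k}` under cone rows, by ✓p675919's uniform engines (`Ψ₀ = C`, `Ψ₁ = C·3c_d∕(2ℓ)`, `Ψ₂ = C·9d·c_d²∕ℓ²`, `ℓ = L^k`, `c_d = 10√d+6`)

Cell `ym3-torus`, width seat `ym3-torus-px22` (gen 3); companion of ✓p679067 `…TransplantGen0Numbers` (same `ψ`, same cone letters `t₁ z ≤ A₁(r+1)`, `t₂ z ≤ A₀ + A₂(r+2)`).  THEOREMS ONLY (0 `def`, 0 `sorry`);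
`--supports stmt-QuantumFields-19200`, count-neutral.  YM₃ on T³ is a ladder rung (R3), not the Clay problem; nothing here claims the stub, the crux, d = 4 or the gap.

WHAT IS PROVED (ns `…Theorems.Prop7TransplantNearDatum`).
* §1 `card_ball_le'` (`#S′ ≤ (2(9n + L^k + 1))^d`), `not_mem_ball'`.
* §2 ★★★ `exists_nearDatum_numbers` — for `ψ` with `|ψ| ≤ C₀` vanishing for `tdist(·,b) ≥ 9n` (`3 ≤ L^k`, `k ≤ m+K`): `∃ ψ̃`, `ψ̃(e_y) = ψ(e_y)` for every centre, and for every bi-contractive `U`, `Fr`, cone functions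
  `t₁ t₂` with the displayed rows on `S′`, every `Y`, `ω ≤ Ω` on `S′`: (N₃⁰) `Σ_z √hs(Δ_U(ψ̃•R(Fr)Y) z) ≤ (2(9n+L^k+1))^d·𝔅` and (N₄⁰) `√Σω²hs(Δ_U(ψ̃•R(Fr)Y)) ≤ Ω·√((2(9n+L^k+1))^d)·𝔅`,
  `𝔅 := C₀(9d·c_d²∕ℓ²)·√hs Y + √N‖Y‖·d·((2τ₂ + 4τ₁²)C₀ + 4τ₁·C₀·3c_d∕(2ℓ))`, `τ₁ := A₁(9n+L^k+1)`, `τ₂ := A₀ + A₂(9n+L^k+2)`.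
HONEST SCOPE.  Counting over landed engines; at the member (`n = ℓ`): `N₃⁰ ≍ ℓ³·(ℓ⁻² + e∕ℓ²·…) ≍ ℓ`, `N₄⁰ ≍ Ω·ℓ^{3∕2}·ℓ⁻² ≍ ℓ^{−1∕2}` ⇒ `3W·N₄⁰ ≍ ℓ`.

References: T. Bałaban, CMP 99 (1985) 389–434 [Balaban1985BackgroundPropagators] ((3.35) p.396); CMP 96 (1984) 223–250 [Balaban1984PropagatorsII] ((1.9) p.226); CMP 99 (1985) 75–102
[Balaban1985RegularSpaces] ((1.14) p.78).
-/

set_option autoImplicit false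

noncomputable section

open scoped BigOperators Matrix.Norms.L2Operator Matrix
open Finset

namespace Summit.QuantumFields.YangMills.Theorems.Prop7TransplantNearDatum

open Literature.MathematicalPhysics.QuantumFieldTheory.Balaban1983to89
open LatticeFieldCalculus (laplace)
open B9Eq39Adjoint (R R_def covD covDstar divB)
open B9TorusCalculus (torusT torusT_apply torusT_symm_apply)
open B15DeterminingSets (embIter)
open B3Taylor310LocalRemainder (tdist_comm tdist_self)
open Prop7PinnedKernelGeometry (tdist_le_tdist_shift_add_one tdist_le_tdist_unshift_add_one)
open Prop7TransplantDipolePotential (laplace_one_eq_sum_torusT)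
open Prop7TransplantBumpRows (exists_bump_rows bumpInterp_rows)
open Prop7TransplantNorms (sum_sqrt_hs_covLaplace_framedConst_le_card_mul sqrt_weighted_hs_covLaplace_framedConst_le)
open Prop7TorusRadialSums (card_ball_le_real)

variable {P : Params}

/-! ## §1 The ball `S′ = {tdist(·,b) ≤ 9n + L^k}` -/

/-- `#S′ ≤ (2(9n + L^k + 1))^d`. [folklore] -/
theorem card_ball_le' (b : Site P 0) (n k : ℕ) :
    (((univ.filter fun z : Site P 0 => Site.tdist z b ≤ 9 * n + P.L ^ k)).card : ℝ) ≤ (2 * ((9 * n : ℝ) + (P.L : ℝ) ^ k + 1)) ^ P.d := by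
  have h := card_ball_le_real (P := P) (j := 0) b (9 * n + P.L ^ k)
  push_cast at h
  exact h

/-- membership in `S′`. [folklore] -/
theorem mem_ball_iff' (b z : Site P 0) (n k : ℕ) : z ∈ (univ.filter fun z : Site P 0 => Site.tdist z b ≤ 9 * n + P.L ^ k) ↔ Site.tdist z b ≤ 9 * n + P.L ^ k := by
  simp only [Finset.mem_filter, Finset.mem_univ, true_and]

/-! ## §2 ★★★ The near datum and its numbers -/

/-- ★★★ **THE gen-0 NEAR DATUM AND ITS NUMBERS** (see the module docstring). [cite: Balaban1985BackgroundPropagators, (3.35) p.396; Balaban1984PropagatorsII, (1.9) p.226; Balaban1985RegularSpaces, (1.14) p.78] -/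
theorem exists_nearDatum_numbers [DecidableEq (Site P 0)] {k : ℕ} (hk : k ≤ P.m + P.K) (h3 : 3 ≤ P.L ^ k) (b : Site P 0) (n : ℕ)
    (ψ : Site P 0 → ℝ) {C₀ : ℝ} (hC₀ : 0 ≤ C₀) (hψ0 : ∀ z, |ψ z| ≤ C₀) (hψsupp : ∀ z, (9 * n : ℝ) ≤ (Site.tdist z b : ℝ) → ψ z = 0) :
    ∃ ψt : Site P 0 → ℝ,
      (∀ y : Site P k, ψt (embIter k y) = ψ (embIter k y)) ∧
      (∀ z, |ψt z| ≤ C₀) ∧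
      ∀ {N : ℕ} (U : Fin P.d → Site P 0 → (Matrix (Fin N) (Fin N) ℂ)ˣ) (Fr : Site P 0 → (Matrix (Fin N) (Fin N) ℂ)ˣ)
        (_ : ∀ (κ : Fin P.d) (y : Site P 0), ‖(U κ y : Matrix (Fin N) (Fin N) ℂ)‖ ≤ 1 ∧ ‖(((U κ y)⁻¹ : (Matrix (Fin N) (Fin N) ℂ)ˣ) : Matrix (Fin N) (Fin N) ℂ)‖ ≤ 1)
        (_ : ∀ z : Site P 0, ‖(Fr z : Matrix (Fin N) (Fin N) ℂ)‖ ≤ 1 ∧ ‖(((Fr z)⁻¹ : (Matrix (Fin N) (Fin N) ℂ)ˣ) : Matrix (Fin N) (Fin N) ℂ)‖ ≤ 1)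
        (t₁ t₂ : Site P 0 → ℝ) (A₀ A₁ A₂ : ℝ) (_ : 0 ≤ A₀) (_ : 0 ≤ A₁) (_ : 0 ≤ A₂)
        (_ : ∀ z ∈ (univ.filter fun z : Site P 0 => Site.tdist z b ≤ 9 * n + P.L ^ k), 0 ≤ t₁ z ∧ t₁ z ≤ A₁ * ((Site.tdist z b : ℝ) + 1))
        (_ : ∀ z ∈ (univ.filter fun z : Site P 0 => Site.tdist z b ≤ 9 * n + P.L ^ k), t₂ z ≤ A₀ + A₂ * ((Site.tdist z b : ℝ) + 2))
        (_ : ∀ z ∈ (univ.filter fun z : Site P 0 => Site.tdist z b ≤ 9 * n + P.L ^ k), ∀ μ,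
          ‖(((Fr z)⁻¹ * U μ z * Fr (torusT P 0 μ z) : (Matrix (Fin N) (Fin N) ℂ)ˣ) : Matrix (Fin N) (Fin N) ℂ) - 1‖ ≤ t₁ z)
        (_ : ∀ z ∈ (univ.filter fun z : Site P 0 => Site.tdist z b ≤ 9 * n + P.L ^ k), ∀ μ,
          ‖(((Fr ((torusT P 0 μ).symm z))⁻¹ * U μ ((torusT P 0 μ).symm z) * Fr (torusT P 0 μ ((torusT P 0 μ).symm z)) : (Matrix (Fin N) (Fin N) ℂ)ˣ) :
            Matrix (Fin N) (Fin N) ℂ) - 1‖ ≤ t₁ z)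
        (_ : ∀ z ∈ (univ.filter fun z : Site P 0 => Site.tdist z b ≤ 9 * n + P.L ^ k), ∀ μ,
          ‖(((Fr z)⁻¹ * U μ z * Fr (torusT P 0 μ z) : (Matrix (Fin N) (Fin N) ℂ)ˣ) : Matrix (Fin N) (Fin N) ℂ)
            - (((Fr ((torusT P 0 μ).symm z))⁻¹ * U μ ((torusT P 0 μ).symm z) * Fr (torusT P 0 μ ((torusT P 0 μ).symm z)) : (Matrix (Fin N) (Fin N) ℂ)ˣ) :
              Matrix (Fin N) (Fin N) ℂ)‖ ≤ t₂ z)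
        (Y : Matrix (Fin N) (Fin N) ℂ) (ω : Site P 0 → ℝ) (Ω : ℝ) (_ : ∀ z ∈ (univ.filter fun z : Site P 0 => Site.tdist z b ≤ 9 * n + P.L ^ k), 0 ≤ ω z ∧ ω z ≤ Ω),
        (∑ z, Real.sqrt (∑ j : Fin N, ∑ k' : Fin N, ‖(divB (torusT P 0) U (fun μ => covD (torusT P 0) U μ (fun y => ψt y • R (Fr y) Y)) z) j k'‖ ^ 2)
          ≤ (2 * ((9 * n : ℝ) + (P.L : ℝ) ^ k + 1)) ^ P.d
            * (C₀ * (9 * P.d * (10 * Real.sqrt P.d + 6) ^ 2 / ((P.L : ℝ) ^ k) ^ 2) * Real.sqrt (∑ j : Fin N, ∑ k' : Fin N, ‖Y j k'‖ ^ 2)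
              + Real.sqrt N * ‖Y‖ * (P.d * ((2 * (A₀ + A₂ * ((9 * n : ℝ) + (P.L : ℝ) ^ k + 2)) + 4 * (A₁ * ((9 * n : ℝ) + (P.L : ℝ) ^ k + 1)) ^ 2) * C₀
                + 4 * (A₁ * ((9 * n : ℝ) + (P.L : ℝ) ^ k + 1)) * (C₀ * (3 * (10 * Real.sqrt P.d + 6) / (2 * ((P.L : ℝ) ^ k)))))))) ∧
        (Real.sqrt (∑ z, ω z ^ 2 * ∑ j : Fin N, ∑ k' : Fin N, ‖(divB (torusT P 0) U (fun μ => covD (torusT P 0) U μ (fun y => ψt y • R (Fr y) Y)) z) j k'‖ ^ 2)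
          ≤ Ω * Real.sqrt ((2 * ((9 * n : ℝ) + (P.L : ℝ) ^ k + 1)) ^ P.d)
            * (C₀ * (9 * P.d * (10 * Real.sqrt P.d + 6) ^ 2 / ((P.L : ℝ) ^ k) ^ 2) * Real.sqrt (∑ j : Fin N, ∑ k' : Fin N, ‖Y j k'‖ ^ 2)
              + Real.sqrt N * ‖Y‖ * (P.d * ((2 * (A₀ + A₂ * ((9 * n : ℝ) + (P.L : ℝ) ^ k + 2)) + 4 * (A₁ * ((9 * n : ℝ) + (P.L : ℝ) ^ k + 1)) ^ 2) * C₀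
                + 4 * (A₁ * ((9 * n : ℝ) + (P.L : ℝ) ^ k + 1)) * (C₀ * (3 * (10 * Real.sqrt P.d + 6) / (2 * ((P.L : ℝ) ^ k)))))))) := by
  classical
  obtain ⟨β, B₁, B₂, rS, hB₁0, hB₁, hB₂0, hB₂, hsep, hβ1, hβ01, hβ0, hβd, hβL⟩ := exists_bump_rows (P := P) hk h3
  -- the datum on the centres: `a_y := ψ(e_y)`, vanishing unless `tdist(e_y, b) < 9n`
  have ha0 : ∀ y : Site P k, 9 * n ≤ Site.tdist (embIter k y) b → ψ (embIter k y) = 0 := fun y hy => hψsupp _ (by exact_mod_cast hy)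
  obtain ⟨hval, hΨ0, hΨ1, hΨ2, hfar⟩ := bumpInterp_rows hk β hsep hβ1 hβ01 hβ0 hβd hβL (fun y => ψ (embIter k y)) b (R := 9 * n) hC₀ (fun y => hψ0 _) ha0
  refine ⟨fun z => ∑ y, ψ (embIter k y) * β y z, hval, hΨ0, ?_⟩
  intro N U Fr hU hFr t₁ t₂ A₀ A₁ A₂ hA₀ hA₁ hA₂ ht₁ ht₂ h1 h1' h2 Y ω Ω hω
  set S : Finset (Site P 0) := univ.filter fun z : Site P 0 => Site.tdist z b ≤ 9 * n + P.L ^ k with hSdef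
  set τ₁ : ℝ := A₁ * ((9 * n : ℝ) + (P.L : ℝ) ^ k + 1) with hτ₁
  set τ₂ : ℝ := A₀ + A₂ * ((9 * n : ℝ) + (P.L : ℝ) ^ k + 2) with hτ₂
  have hτ₁0 : 0 ≤ τ₁ := by rw [hτ₁]; positivity
  -- support: `ψ̃` and its neighbours vanish off `S` (`r_S + 1 ≤ L^k`)
  have hS : ∀ z ∉ S, (fun z => ∑ y, ψ (embIter k y) * β y z) z = 0 ∧ (∀ μ, (fun z => ∑ y, ψ (embIter k y) * β y z) (torusT P 0 μ z) = 0) ∧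
      ∀ μ, (fun z => ∑ y, ψ (embIter k y) * β y z) ((torusT P 0 μ).symm z) = 0 := by
    intro z hz
    rw [hSdef, Finset.mem_filter, not_and] at hz
    have hz' : 9 * n + rS + 2 ≤ Site.tdist z b := by
      have := not_le.1 (hz (Finset.mem_univ z)); omega
    obtain ⟨h0, hs, hu⟩ := hfar z hz'
    exact ⟨h0, fun μ => by rw [torusT_apply]; exact hs μ, fun μ => by rw [torusT_symm_apply]; exact hu μ⟩
  -- uniform cone rows on `S`
  have hmemS : ∀ z ∈ S, Site.tdist z b ≤ 9 * n + P.L ^ k := fun z hz => (mem_ball_iff' b z n k).1 hz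
  have hrS : ∀ z ∈ S, ((Site.tdist z b : ℕ) : ℝ) ≤ 9 * n + (P.L : ℝ) ^ k := fun z hz => by exact_mod_cast hmemS z hz
  have hτ₁S : ∀ z ∈ S, t₁ z ≤ τ₁ := fun z hz => (ht₁ z hz).2.trans (by rw [hτ₁]; nlinarith [hrS z hz])
  have hτ₂S : ∀ z ∈ S, t₂ z ≤ τ₂ := fun z hz => (ht₂ z hz).trans (by rw [hτ₂]; nlinarith [hrS z hz])
  have h1u : ∀ z ∈ S, ∀ μ, ‖(((Fr z)⁻¹ * U μ z * Fr (torusT P 0 μ z) : (Matrix (Fin N) (Fin N) ℂ)ˣ) : Matrix (Fin N) (Fin N) ℂ) - 1‖ ≤ τ₁ :=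
    fun z hz μ => (h1 z hz μ).trans (hτ₁S z hz)
  have h1u' : ∀ z ∈ S, ∀ μ, ‖(((Fr ((torusT P 0 μ).symm z))⁻¹ * U μ ((torusT P 0 μ).symm z) * Fr (torusT P 0 μ ((torusT P 0 μ).symm z)) : (Matrix (Fin N) (Fin N) ℂ)ˣ) :
      Matrix (Fin N) (Fin N) ℂ) - 1‖ ≤ τ₁ := fun z hz μ => (h1' z hz μ).trans (hτ₁S z hz)
  have h2u : ∀ z ∈ S, ∀ μ, ‖(((Fr z)⁻¹ * U μ z * Fr (torusT P 0 μ z) : (Matrix (Fin N) (Fin N) ℂ)ˣ) : Matrix (Fin N) (Fin N) ℂ)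
      - (((Fr ((torusT P 0 μ).symm z))⁻¹ * U μ ((torusT P 0 μ).symm z) * Fr (torusT P 0 μ ((torusT P 0 μ).symm z)) : (Matrix (Fin N) (Fin N) ℂ)ˣ) :
        Matrix (Fin N) (Fin N) ℂ)‖ ≤ τ₂ := fun z hz μ => (h2 z hz μ).trans (hτ₂S z hz)
  -- the three rows of `ψ̃` in the engine's letters, with `B₁ B₂` replaced by their `ℓ`-bounds
  have hΨ0S : ∀ z ∈ S, |(fun z => ∑ y, ψ (embIter k y) * β y z) z| ≤ C₀ := fun z _ => hΨ0 z
  have hΨ1S : ∀ z ∈ S, ∀ μ, |(fun z => ∑ y, ψ (embIter k y) * β y z) (torusT P 0 μ z) - (fun z => ∑ y, ψ (embIter k y) * β y z) z| ≤ C₀ * (3 * (10 * Real.sqrt P.d + 6) / (2 * ((P.L : ℝ) ^ k)))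
      ∧ |(fun z => ∑ y, ψ (embIter k y) * β y z) ((torusT P 0 μ).symm z) - (fun z => ∑ y, ψ (embIter k y) * β y z) z| ≤ C₀ * (3 * (10 * Real.sqrt P.d + 6) / (2 * ((P.L : ℝ) ^ k))) := by
    intro z _ μ
    have hm := mul_le_mul_of_nonneg_left hB₁ hC₀
    simp only [torusT_apply, torusT_symm_apply]
    exact ⟨(hΨ1 z μ).1.trans hm, (hΨ1 z μ).2.trans hm⟩
  have hΨ2S : ∀ z ∈ S, |∑ μ : Fin P.d, (2 * (fun z => ∑ y, ψ (embIter k y) * β y z) z - (fun z => ∑ y, ψ (embIter k y) * β y z) (torusT P 0 μ z)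
      - (fun z => ∑ y, ψ (embIter k y) * β y z) ((torusT P 0 μ).symm z))| ≤ C₀ * (9 * P.d * (10 * Real.sqrt P.d + 6) ^ 2 / ((P.L : ℝ) ^ k) ^ 2) := by
    intro z _
    rw [← laplace_one_eq_sum_torusT (fun z => ∑ y, ψ (embIter k y) * β y z) z]
    exact (hΨ2 z).trans (mul_le_mul_of_nonneg_left hB₂ hC₀)
  have hcard := card_ball_le' (P := P) b n k
  set 𝔅 : ℝ := C₀ * (9 * P.d * (10 * Real.sqrt P.d + 6) ^ 2 / ((P.L : ℝ) ^ k) ^ 2) * Real.sqrt (∑ j : Fin N, ∑ k' : Fin N, ‖Y j k'‖ ^ 2)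
    + Real.sqrt N * ‖Y‖ * (P.d * ((2 * τ₂ + 4 * τ₁ ^ 2) * C₀ + 4 * τ₁ * (C₀ * (3 * (10 * Real.sqrt P.d + 6) / (2 * ((P.L : ℝ) ^ k)))))) with h𝔅
  have h𝔅0 : 0 ≤ 𝔅 := by
    have hτ₂0 : 0 ≤ τ₂ := by rw [hτ₂]; positivity
    rw [h𝔅]; positivity
  constructor
  · -- (N₃⁰)
    have h := sum_sqrt_hs_covLaplace_framedConst_le_card_mul U Fr hU hFr (fun z => ∑ y, ψ (embIter k y) * β y z) Y S hS hτ₁0 h1u h1u' h2u hΨ0S hΨ1S hΨ2S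
    refine h.trans ?_
    calc (S.card : ℝ) * _ ≤ (2 * ((9 * n : ℝ) + (P.L : ℝ) ^ k + 1)) ^ P.d * 𝔅 := by rw [h𝔅]; exact mul_le_mul_of_nonneg_right hcard h𝔅0
      _ = _ := by rw [h𝔅]
  · -- (N₄⁰)
    have h := sqrt_weighted_hs_covLaplace_framedConst_le U Fr hU hFr (fun z => ∑ y, ψ (embIter k y) * β y z) Y S hS ω hω hτ₁0 h1u h1u' h2u hΨ0S hΨ1S hΨ2S
    refine h.trans ?_
    have hbS : b ∈ S := by rw [mem_ball_iff', tdist_self]; exact Nat.zero_le _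
    have hΩ : 0 ≤ Ω := (hω b hbS).1.trans (hω b hbS).2
    calc Ω * Real.sqrt S.card * _ ≤ Ω * Real.sqrt ((2 * ((9 * n : ℝ) + (P.L : ℝ) ^ k + 1)) ^ P.d) * 𝔅 := by
          rw [h𝔅]; exact mul_le_mul_of_nonneg_right (mul_le_mul_of_nonneg_left (Real.sqrt_le_sqrt hcard) hΩ) h𝔅0
      _ = _ := by rw [h𝔅]

end Summit.QuantumFields.YangMills.Theorems.Prop7TransplantNearDatum

end
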